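import Summits.RiemannHypothesis.RiemannHypothesis.Theorems.SemilocalNegCertUptoHundredThirtyNineKinkedQ
import Summits.RiemannHypothesis.RiemannHypothesis.Theorems.SemilocalNegCertUptoHundredThirtyNineKinkedR
import Summits.RiemannHypothesis.RiemannHypothesis.Theorems.SemilocalNegCertUptoHundredThirtyNineKinkedS
import Summits.RiemannHypothesis.RiemannHypothesis.Theorems.SemilocalNegCertUptoHundredThirtyNineKinkedU
import Summits.RiemannHypothesis.RiemannHypothesis.Theorems.SemilocalNegCertUptoHundredThirtyNineKinkedV
import Summits.RiemannHypothesis.RiemannHypothesis.Theorems.SemilocalNegCertUptoHundredThirtyNineKinkedW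
import Summits.RiemannHypothesis.RiemannHypothesis.Theorems.SemilocalNegCertUptoHundredThirtyNineKinkedX
import Summits.RiemannHypothesis.RiemannHypothesis.Theorems.SemilocalNegCertUptoHundredThirtyNineKinkedY
import Summits.RiemannHypothesis.RiemannHypothesis.Theorems.SemilocalNegCertUptoHundredThirtyNineKinkedZ
import Summits.RiemannHypothesis.RiemannHypothesis.Theorems.SemilocalNegCertUptoHundredThirtyNineKinkedBa
import Summits.RiemannHypothesis.RiemannHypothesis.Theorems.SemilocalNegCertUptoHundredThirtyNineKinkedBb
import HarnessLib

/-!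
# Semi-local threshold of the `{∞} ∪ {p < 149}` form, negative side: `a*({2,…,139}) ≤ 321/128` — the wall `q = 149` from a KINKED (piecewise-cubic) witness (part 14/18: the composition of the piece facts 300 … 449)

Cell `rh-explicit` (HOME `run/shared/lean/pub/rh-explicit/`), seat cc-s2-4 (A4 SEMILOCAL-TABLE, kernel column; pipeline gen11 `mkkinked.py`).
Honest framing: theorems about the tree's `weilSemilocalThreshold S`; nothing here bears on RH.  No data is trusted: every bound is a
`decide +kernel` fact of the piecewise certificate `SemilocalPiecewiseCert.lean` (cc-s2-4 gen8).

Instance: `S = {p < 149}`, window `b = 321/128` (last /1024 value below `(log 151)/2`), `N = 150`, 47 atoms; odd piecewise-cubic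
witness with 24 slope breaks at the atom images `|b − log n|` nearest `0` (atoms `n = 13, 11, 16, 9, 17, 8, 19, 7, 23, 25, 27, 29, 5, 31, 32, 37, 4, 41, 43, 47, 49, 3, 53, 59`,
rounded to `/1024`); float finder `Re Q/‖G‖² = -1.416e-04` (no polar credit); orders `(10, 4, 8, 4, 10, 40)`, 605 `t`-pieces
(far widths ≤ 1/4); exact kernel margin `(rhs − lhs)/‖G‖² = 1.4144e-04`.  ⇒ **`a*({p < 149}) ≤ 321/128 < (log 151)/2`**.
The instance is split for the gate into part 1
(table, certificate, `checkMainPW`, the atom side in kernel chunks of ≤ 4 atoms via `SemilocalPiecewiseCertSplit.lean`), parts 2–10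
(68 piece facts each in the FLEX layout of `SemilocalPiecewiseCertFlex.lean` (cc-s2-4 gen12, CC4-LEAN §17.2): piece `0` by `checkPiecePW`,
every far piece by `checkPieceFlex i ⟨n, m, K, m', u₀⟩` with the orders that piece needs (mean majorant degree ≈ 62 instead of 176) and a
short dyadic centre `u₀ ≤ u_K(T₀)` — same witness, same cuts, claims recomputed (`⌈exact⌉ + 1`), kernel margin `1.4142e-04`·‖G‖²; each
fact file imports part 1 only), the Pieces part (composition) and the Final part (theorems).  Folklore throughout.
-/

set_option autoImplicit false
set_option linter.dupNamespace false  -- the mandated namespace repeats `RiemannHypothesis`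
set_option Elab.async false  -- serialise the kernel facts: in parallel they exhaust the node's per-process heap (cc-s2-4 gen11, CC4-LEAN §16.10)

noncomputable section

open Complex Filter Set MeasureTheory Topology
open scoped Real

namespace Summit.RiemannHypothesis.RiemannHypothesis.Theorems.SemilocalPolyWitness

open MeasureTheory Set Finset Real
open Literature.NumberTheory.LFunctions
open Summit.RiemannHypothesis.RiemannHypothesis.Theorems.MotivicDoor
open Summit.RiemannHypothesis.RiemannHypothesis.Theorems.MotivicDoor.SemilocalThreshold
open Summit.RiemannHypothesis.RiemannHypothesis.Theorems.MotivicDoor.SemilocalMarkov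
open LQ

/-- pieces `300 ≤ i < 450` of `certUptoHundredThirtyNineKinked` check (FLEX form). -/
theorem check_UptoHundredThirtyNineKinked_pieces_3 : ∀ i, 300 ≤ i → i < 450 →
    certUptoHundredThirtyNineKinked.checkPiecePW i = true ∨ ∃ o, certUptoHundredThirtyNineKinked.checkPieceFlex i o = true := by
  intro i hlo hhi
  interval_cases i
  · exact Or.inr ⟨_, check_UptoHundredThirtyNineKinked_piece300⟩
  · exact Or.inr ⟨_, check_UptoHundredThirtyNineKinked_piece301⟩
  · exact Or.inr ⟨_, check_UptoHundredThirtyNineKinked_piece302⟩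
  · exact Or.inr ⟨_, check_UptoHundredThirtyNineKinked_piece303⟩
  · exact Or.inr ⟨_, check_UptoHundredThirtyNineKinked_piece304⟩
  · exact Or.inr ⟨_, check_UptoHundredThirtyNineKinked_piece305⟩
  · exact Or.inr ⟨_, check_UptoHundredThirtyNineKinked_piece306⟩
  · exact Or.inr ⟨_, check_UptoHundredThirtyNineKinked_piece307⟩
  · exact Or.inr ⟨_, check_UptoHundredThirtyNineKinked_piece308⟩
  · exact Or.inr ⟨_, check_UptoHundredThirtyNineKinked_piece309⟩
  · exact Or.inr ⟨_, check_UptoHundredThirtyNineKinked_piece310⟩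
  · exact Or.inr ⟨_, check_UptoHundredThirtyNineKinked_piece311⟩
  · exact Or.inr ⟨_, check_UptoHundredThirtyNineKinked_piece312⟩
  · exact Or.inr ⟨_, check_UptoHundredThirtyNineKinked_piece313⟩
  · exact Or.inr ⟨_, check_UptoHundredThirtyNineKinked_piece314⟩
  · exact Or.inr ⟨_, check_UptoHundredThirtyNineKinked_piece315⟩
  · exact Or.inr ⟨_, check_UptoHundredThirtyNineKinked_piece316⟩
  · exact Or.inr ⟨_, check_UptoHundredThirtyNineKinked_piece317⟩
  · exact Or.inr ⟨_, check_UptoHundredThirtyNineKinked_piece318⟩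
  · exact Or.inr ⟨_, check_UptoHundredThirtyNineKinked_piece319⟩
  · exact Or.inr ⟨_, check_UptoHundredThirtyNineKinked_piece320⟩
  · exact Or.inr ⟨_, check_UptoHundredThirtyNineKinked_piece321⟩
  · exact Or.inr ⟨_, check_UptoHundredThirtyNineKinked_piece322⟩
  · exact Or.inr ⟨_, check_UptoHundredThirtyNineKinked_piece323⟩
  · exact Or.inr ⟨_, check_UptoHundredThirtyNineKinked_piece324⟩
  · exact Or.inr ⟨_, check_UptoHundredThirtyNineKinked_piece325⟩
  · exact Or.inr ⟨_, check_UptoHundredThirtyNineKinked_piece326⟩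
  · exact Or.inr ⟨_, check_UptoHundredThirtyNineKinked_piece327⟩
  · exact Or.inr ⟨_, check_UptoHundredThirtyNineKinked_piece328⟩
  · exact Or.inr ⟨_, check_UptoHundredThirtyNineKinked_piece329⟩
  · exact Or.inr ⟨_, check_UptoHundredThirtyNineKinked_piece330⟩
  · exact Or.inr ⟨_, check_UptoHundredThirtyNineKinked_piece331⟩
  · exact Or.inr ⟨_, check_UptoHundredThirtyNineKinked_piece332⟩
  · exact Or.inr ⟨_, check_UptoHundredThirtyNineKinked_piece333⟩
  · exact Or.inr ⟨_, check_UptoHundredThirtyNineKinked_piece334⟩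
  · exact Or.inr ⟨_, check_UptoHundredThirtyNineKinked_piece335⟩
  · exact Or.inr ⟨_, check_UptoHundredThirtyNineKinked_piece336⟩
  · exact Or.inr ⟨_, check_UptoHundredThirtyNineKinked_piece337⟩
  · exact Or.inr ⟨_, check_UptoHundredThirtyNineKinked_piece338⟩
  · exact Or.inr ⟨_, check_UptoHundredThirtyNineKinked_piece339⟩
  · exact Or.inr ⟨_, check_UptoHundredThirtyNineKinked_piece340⟩
  · exact Or.inr ⟨_, check_UptoHundredThirtyNineKinked_piece341⟩
  · exact Or.inr ⟨_, check_UptoHundredThirtyNineKinked_piece342⟩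
  · exact Or.inr ⟨_, check_UptoHundredThirtyNineKinked_piece343⟩
  · exact Or.inr ⟨_, check_UptoHundredThirtyNineKinked_piece344⟩
  · exact Or.inr ⟨_, check_UptoHundredThirtyNineKinked_piece345⟩
  · exact Or.inr ⟨_, check_UptoHundredThirtyNineKinked_piece346⟩
  · exact Or.inr ⟨_, check_UptoHundredThirtyNineKinked_piece347⟩
  · exact Or.inr ⟨_, check_UptoHundredThirtyNineKinked_piece348⟩
  · exact Or.inr ⟨_, check_UptoHundredThirtyNineKinked_piece349⟩
  · exact Or.inr ⟨_, check_UptoHundredThirtyNineKinked_piece350⟩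
  · exact Or.inr ⟨_, check_UptoHundredThirtyNineKinked_piece351⟩
  · exact Or.inr ⟨_, check_UptoHundredThirtyNineKinked_piece352⟩
  · exact Or.inr ⟨_, check_UptoHundredThirtyNineKinked_piece353⟩
  · exact Or.inr ⟨_, check_UptoHundredThirtyNineKinked_piece354⟩
  · exact Or.inr ⟨_, check_UptoHundredThirtyNineKinked_piece355⟩
  · exact Or.inr ⟨_, check_UptoHundredThirtyNineKinked_piece356⟩
  · exact Or.inr ⟨_, check_UptoHundredThirtyNineKinked_piece357⟩
  · exact Or.inr ⟨_, check_UptoHundredThirtyNineKinked_piece358⟩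
  · exact Or.inr ⟨_, check_UptoHundredThirtyNineKinked_piece359⟩
  · exact Or.inr ⟨_, check_UptoHundredThirtyNineKinked_piece360⟩
  · exact Or.inr ⟨_, check_UptoHundredThirtyNineKinked_piece361⟩
  · exact Or.inr ⟨_, check_UptoHundredThirtyNineKinked_piece362⟩
  · exact Or.inr ⟨_, check_UptoHundredThirtyNineKinked_piece363⟩
  · exact Or.inr ⟨_, check_UptoHundredThirtyNineKinked_piece364⟩
  · exact Or.inr ⟨_, check_UptoHundredThirtyNineKinked_piece365⟩
  · exact Or.inr ⟨_, check_UptoHundredThirtyNineKinked_piece366⟩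
  · exact Or.inr ⟨_, check_UptoHundredThirtyNineKinked_piece367⟩
  · exact Or.inr ⟨_, check_UptoHundredThirtyNineKinked_piece368⟩
  · exact Or.inr ⟨_, check_UptoHundredThirtyNineKinked_piece369⟩
  · exact Or.inr ⟨_, check_UptoHundredThirtyNineKinked_piece370⟩
  · exact Or.inr ⟨_, check_UptoHundredThirtyNineKinked_piece371⟩
  · exact Or.inr ⟨_, check_UptoHundredThirtyNineKinked_piece372⟩
  · exact Or.inr ⟨_, check_UptoHundredThirtyNineKinked_piece373⟩
  · exact Or.inr ⟨_, check_UptoHundredThirtyNineKinked_piece374⟩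
  · exact Or.inr ⟨_, check_UptoHundredThirtyNineKinked_piece375⟩
  · exact Or.inr ⟨_, check_UptoHundredThirtyNineKinked_piece376⟩
  · exact Or.inr ⟨_, check_UptoHundredThirtyNineKinked_piece377⟩
  · exact Or.inr ⟨_, check_UptoHundredThirtyNineKinked_piece378⟩
  · exact Or.inr ⟨_, check_UptoHundredThirtyNineKinked_piece379⟩
  · exact Or.inr ⟨_, check_UptoHundredThirtyNineKinked_piece380⟩
  · exact Or.inr ⟨_, check_UptoHundredThirtyNineKinked_piece381⟩
  · exact Or.inr ⟨_, check_UptoHundredThirtyNineKinked_piece382⟩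
  · exact Or.inr ⟨_, check_UptoHundredThirtyNineKinked_piece383⟩
  · exact Or.inr ⟨_, check_UptoHundredThirtyNineKinked_piece384⟩
  · exact Or.inr ⟨_, check_UptoHundredThirtyNineKinked_piece385⟩
  · exact Or.inr ⟨_, check_UptoHundredThirtyNineKinked_piece386⟩
  · exact Or.inr ⟨_, check_UptoHundredThirtyNineKinked_piece387⟩
  · exact Or.inr ⟨_, check_UptoHundredThirtyNineKinked_piece388⟩
  · exact Or.inr ⟨_, check_UptoHundredThirtyNineKinked_piece389⟩
  · exact Or.inr ⟨_, check_UptoHundredThirtyNineKinked_piece390⟩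
  · exact Or.inr ⟨_, check_UptoHundredThirtyNineKinked_piece391⟩
  · exact Or.inr ⟨_, check_UptoHundredThirtyNineKinked_piece392⟩
  · exact Or.inr ⟨_, check_UptoHundredThirtyNineKinked_piece393⟩
  · exact Or.inr ⟨_, check_UptoHundredThirtyNineKinked_piece394⟩
  · exact Or.inr ⟨_, check_UptoHundredThirtyNineKinked_piece395⟩
  · exact Or.inr ⟨_, check_UptoHundredThirtyNineKinked_piece396⟩
  · exact Or.inr ⟨_, check_UptoHundredThirtyNineKinked_piece397⟩
  · exact Or.inr ⟨_, check_UptoHundredThirtyNineKinked_piece398⟩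
  · exact Or.inr ⟨_, check_UptoHundredThirtyNineKinked_piece399⟩
  · exact Or.inr ⟨_, check_UptoHundredThirtyNineKinked_piece400⟩
  · exact Or.inr ⟨_, check_UptoHundredThirtyNineKinked_piece401⟩
  · exact Or.inr ⟨_, check_UptoHundredThirtyNineKinked_piece402⟩
  · exact Or.inr ⟨_, check_UptoHundredThirtyNineKinked_piece403⟩
  · exact Or.inr ⟨_, check_UptoHundredThirtyNineKinked_piece404⟩
  · exact Or.inr ⟨_, check_UptoHundredThirtyNineKinked_piece405⟩
  · exact Or.inr ⟨_, check_UptoHundredThirtyNineKinked_piece406⟩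
  · exact Or.inr ⟨_, check_UptoHundredThirtyNineKinked_piece407⟩
  · exact Or.inr ⟨_, check_UptoHundredThirtyNineKinked_piece408⟩
  · exact Or.inr ⟨_, check_UptoHundredThirtyNineKinked_piece409⟩
  · exact Or.inr ⟨_, check_UptoHundredThirtyNineKinked_piece410⟩
  · exact Or.inr ⟨_, check_UptoHundredThirtyNineKinked_piece411⟩
  · exact Or.inr ⟨_, check_UptoHundredThirtyNineKinked_piece412⟩
  · exact Or.inr ⟨_, check_UptoHundredThirtyNineKinked_piece413⟩
  · exact Or.inr ⟨_, check_UptoHundredThirtyNineKinked_piece414⟩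
  · exact Or.inr ⟨_, check_UptoHundredThirtyNineKinked_piece415⟩
  · exact Or.inr ⟨_, check_UptoHundredThirtyNineKinked_piece416⟩
  · exact Or.inr ⟨_, check_UptoHundredThirtyNineKinked_piece417⟩
  · exact Or.inr ⟨_, check_UptoHundredThirtyNineKinked_piece418⟩
  · exact Or.inr ⟨_, check_UptoHundredThirtyNineKinked_piece419⟩
  · exact Or.inr ⟨_, check_UptoHundredThirtyNineKinked_piece420⟩
  · exact Or.inr ⟨_, check_UptoHundredThirtyNineKinked_piece421⟩
  · exact Or.inr ⟨_, check_UptoHundredThirtyNineKinked_piece422⟩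
  · exact Or.inr ⟨_, check_UptoHundredThirtyNineKinked_piece423⟩
  · exact Or.inr ⟨_, check_UptoHundredThirtyNineKinked_piece424⟩
  · exact Or.inr ⟨_, check_UptoHundredThirtyNineKinked_piece425⟩
  · exact Or.inr ⟨_, check_UptoHundredThirtyNineKinked_piece426⟩
  · exact Or.inr ⟨_, check_UptoHundredThirtyNineKinked_piece427⟩
  · exact Or.inr ⟨_, check_UptoHundredThirtyNineKinked_piece428⟩
  · exact Or.inr ⟨_, check_UptoHundredThirtyNineKinked_piece429⟩
  · exact Or.inr ⟨_, check_UptoHundredThirtyNineKinked_piece430⟩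
  · exact Or.inr ⟨_, check_UptoHundredThirtyNineKinked_piece431⟩
  · exact Or.inr ⟨_, check_UptoHundredThirtyNineKinked_piece432⟩
  · exact Or.inr ⟨_, check_UptoHundredThirtyNineKinked_piece433⟩
  · exact Or.inr ⟨_, check_UptoHundredThirtyNineKinked_piece434⟩
  · exact Or.inr ⟨_, check_UptoHundredThirtyNineKinked_piece435⟩
  · exact Or.inr ⟨_, check_UptoHundredThirtyNineKinked_piece436⟩
  · exact Or.inr ⟨_, check_UptoHundredThirtyNineKinked_piece437⟩
  · exact Or.inr ⟨_, check_UptoHundredThirtyNineKinked_piece438⟩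
  · exact Or.inr ⟨_, check_UptoHundredThirtyNineKinked_piece439⟩
  · exact Or.inr ⟨_, check_UptoHundredThirtyNineKinked_piece440⟩
  · exact Or.inr ⟨_, check_UptoHundredThirtyNineKinked_piece441⟩
  · exact Or.inr ⟨_, check_UptoHundredThirtyNineKinked_piece442⟩
  · exact Or.inr ⟨_, check_UptoHundredThirtyNineKinked_piece443⟩
  · exact Or.inr ⟨_, check_UptoHundredThirtyNineKinked_piece444⟩
  · exact Or.inr ⟨_, check_UptoHundredThirtyNineKinked_piece445⟩
  · exact Or.inr ⟨_, check_UptoHundredThirtyNineKinked_piece446⟩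
  · exact Or.inr ⟨_, check_UptoHundredThirtyNineKinked_piece447⟩
  · exact Or.inr ⟨_, check_UptoHundredThirtyNineKinked_piece448⟩
  · exact Or.inr ⟨_, check_UptoHundredThirtyNineKinked_piece449⟩

end Summit.RiemannHypothesis.RiemannHypothesis.Theorems.SemilocalPolyWitness

end
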